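import Literature.NumberTheory.Transcendental.L2HodgeTheory
import Literature.NumberTheory.Transcendental.FormIntegrationPUProofs
import Literature.Geometry.Kaehler.HodgeStarOfVolumeFormProofs
import Mathlib.Topology.UnitInterval
import Mathlib.MeasureTheory.Measure.Haar.Unique
import Mathlib.Analysis.SpecialFunctions.Integrals.Basic
import HarnessLib

/-!
# The named fact `existsUnique_greenOperator` is false as stated (the interval `[0,1]`)

`Literature/NumberTheory/Transcendental/L2HodgeTheory.lean` records the Green operator of a
closed oriented Riemannian manifold (Warner, *Foundations of Differentiable Manifolds and Lie
Groups*, GTM 94 (1983), Def. 6.9 / Prop. 6.10, PDF p. 201; standing hypothesis of Ch. 6, p. 197: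
"M will be a compact oriented Riemannian manifold") as the named fact
`Literature.NumberTheory.Transcendental.existsUnique_greenOperator o`: for every smooth `k`-form
`α` there is a unique linear `G` on smooth `k`-forms with `Gα ⟂_{L²} Hᵏ` and `α - Δ(Gα) ∈ Hᵏ`.
Its docstring assumes a *closed* manifold and a smooth metric, but the section instances
`[CompactSpace M] [I.Boundaryless] [IsContinuousRiemannianBundle …] [IsContMDiffRiemannianBundle …]`
are unused by the body of this `def … : Prop` and were therefore *not* abstracted (checked:
`#check @existsUnique_greenOperator` binds only `[T2Space M] [SigmaCompactSpace M]
[IsManifold I ∞ M] [RiemannianBundle …]`). As elaborated, the fact thus quantifies over manifolds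
*with boundary* (and non-compact ones, and rough metrics). This file proves that in that
generality it is **false**: `not_forall_existsUnique_greenOperator`, with the concrete instance
`GreenCounterexample.not_existsUnique_greenOperator_unitInterval` — a *compact* manifold with
boundary and a *constant* metric, so the hypothesis that fails is exactly `I.Boundaryless`
(no closed manifold can refute it: there the statement is Warner's theorem). Companion of
`RiemannianHodgeRoughMetric.lean` / `RiemannianHodgeSmoothCounterexample.lean`, which refute the
sibling facts `mem_harmonicForms_iff`, `isSmoothForm_hodgeStar`, `isSmoothForm_mcoderiv` for the
same reason (missing metric-regularity instances).

## The counterexample (`namespace GreenCounterexample`)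

Take `M = H = [0,1]` (`unitInterval`), modelled on itself by the model with corners
`𝓙 : [0,1] → ℝ` (inclusion, inverse `projIcc`; range `Icc 0 1`, so `¬ 𝓙.Boundaryless`), with its
single identity chart, the Euclidean metric `g(u, v) = uv` on `T_x[0,1] = ℝ` (`bundle`, a `def`
used as a *local* instance only), the standard orientation `orient`, and degrees `k = 0`, `m = 1`,
`n = 1`. Everything is computed, with no junk values on `[0,1]`:

* chart representatives are the forms themselves (`inChart_apply_coe`), the chart sign is the
  constant `sign (e 0)` (`e = modelBasis ℝ 1`, `chartSign_apply_coe`), the orientation is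
  continuous and `vol = dt` is smooth (`isSmoothForm_riemannianVolumeForm`: the hypothesis `ho`);
* for a `0`-form `η` with scalar function `f = fn η` one has `dη = f′ dt`, `⋆(g dt) = g`
  (`hodgeStar_volumeFormL_holds`), hence **`Δη = -f″`** with *one-sided* (within-`[0,1]`)
  derivatives at the end points (`hodgeLaplacian_zeroForm`); so the harmonic `0`-forms are the
  affine functions `a + bt`, and every element of the span `harmonicForms` is smooth and affine
  (`isAff_of_mem_harmonicForms`);
* the `L²` product of smooth `0`-forms is `⟪β, η⟫ = K ∫₀¹ fn β · fn η` for a constant `K`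
  (`l2Inner_eq`; the integral `MForm.integral` is evaluated through the discharged fact
  `MForm.integralPU_eq_integral_holds` with the one-function partition of unity `{1}`, and the
  Haar measure of the reference basis is a multiple of Lebesgue measure; the value of `K` is
  irrelevant).

Now let `p(t) = 6t² - 6t + 1`, so that `∫₀¹ p = ∫₀¹ t p = 0` and `p″ = 12`. If `G` has the Green
property, so does `G + L` with `L α = α(0) · p`: `⟪Gα + c p, a + bt⟫ = ⟪Gα, a + bt⟫ + cK·0 = 0`,
and `α - Δ(Gα + c p) = (α - Δ Gα) + 12c` is again in `harmonicForms` (constants are harmonic).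
Since `L 1 = p ≠ 0`, `G + L ≠ G`: uniqueness fails. (On a closed manifold this is impossible:
`Δβ ∈ H` forces `Δβ = 0` by the symmetry of `Δ`, which is exactly what the boundary destroys —
`p ⟂ H⁰` although `p″ ≠ 0`.)

## What this file does not do

It does not restate the fact. The intended statement (Warner 6.9–6.10) binds, inside the `Prop`,
`[CompactSpace M] [I.Boundaryless]` and the metric-regularity classes; discharging it is the Hodge
theorem (elliptic regularity), which the tree does not have.

## References

* F. W. Warner, *Foundations of Differentiable Manifolds and Lie Groups*, GTM 94, Springer (1983),
  Ch. 6: standing hypothesis p. 220 (PDF p. 197), Def. 6.9 and Prop. 6.10 (PDF p. 201).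

## Verdict clean-up note (2026-08-15)

The named fact `existsUnique_greenOperator` is now an `@[deprecated]` record of `L2HodgeTheory.lean`
(mis-stated, resp. refuted as stated: a `def` does not abstract the unused section instances it was
written under; the corrected statements are the ones proved or named in this file and in the
records' docstrings). The declarations `not_existsUnique_greenOperator_unitInterval`,
`not_forall_existsUnique_greenOperator` name the record on purpose, so `linter.deprecated` is
silenced on exactly those declarations (REMOVE-WHEN the records are deleted from
`L2HodgeTheory.lean`).
-/

noncomputable section

open scoped Manifold ContDiff Topology
open Set Module MeasureTheory ContinuousAlternatingMap
open Literature.Geometry.Kaehler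

namespace Literature.NumberTheory.Transcendental

namespace GreenCounterexample

/-! ### The closed unit interval as its own model with corners -/

/-- The unit interval `[0,1] ⊂ ℝ` as a partial equivalence onto `Icc 0 1` (inclusion, inverse
`projIcc`). [folklore] -/
def iccEquiv : PartialEquiv unitInterval ℝ where
  toFun := Subtype.val
  invFun := Set.projIcc 0 1 zero_le_one
  source := univ
  target := Icc 0 1
  map_source' x _ := x.2
  map_target' _ _ := mem_univ _
  left_inv' x _ := Set.projIcc_val zero_le_one x
  right_inv' y hy := by simp [Set.projIcc_of_mem zero_le_one hy]

/-- The model with corners `𝓙 : [0,1] → ℝ` (inclusion, inverse `projIcc`, range `Icc 0 1`): a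
one-dimensional model *with boundary*. [folklore] -/
def 𝓙 : ModelWithCorners ℝ ℝ unitInterval :=
  ModelWithCorners.ofConvexRange iccEquiv rfl (convex_Icc 0 1) continuous_subtype_val
    (continuous_projIcc (h := zero_le_one)) ⟨2⁻¹, by
      change (2⁻¹ : ℝ) ∈ interior (Icc 0 1)
      rw [interior_Icc]; norm_num⟩

/-- `range 𝓙 = [0,1]`. [folklore] -/
theorem range_𝓙 : range 𝓙 = Icc 0 1 := by
  rw [show (𝓙 : unitInterval → ℝ) = Subtype.val from rfl]
  exact Subtype.range_coe

/-- The extended charts of `[0,1]` (a model space: all charts are the identity) are `𝓙`. [folklore] -/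
theorem extChartAt_apply (p x : unitInterval) : extChartAt 𝓙 p x = x.val := rfl

/-- The extended charts of `[0,1]` are defined everywhere. [folklore] -/
theorem extChartAt_source' (p : unitInterval) : (extChartAt 𝓙 p).source = univ := by
  rw [extChartAt_source, chartAt_self_eq]; rfl

/-- Every point lies in every chart source. [folklore] -/
theorem mem_source (p x : unitInterval) : x ∈ (extChartAt 𝓙 p).source := by
  rw [extChartAt_source']; exact mem_univ _

/-- The extended charts of `[0,1]` have target `[0,1]`. [folklore] -/
theorem extChartAt_target' (p : unitInterval) : (extChartAt 𝓙 p).target = Icc 0 1 := by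
  rw [extChartAt_target, chartAt_self_eq, range_𝓙]
  simp

/-- The tangent coordinate changes of `[0,1]` are the identity (a single chart). [folklore] -/
theorem tangentCoordChange_eq (p x : unitInterval) (v : ℝ) :
    tangentCoordChange 𝓙 p x x v = v := by
  rw [show tangentCoordChange 𝓙 p x x = tangentCoordChange 𝓙 x x x from rfl]
  exact tangentCoordChange_self (mem_source x x)

/-- **Chart representatives are the forms themselves** on `[0,1]`: `α̂_p(x) = α(x)` for
`x ∈ [0,1]` (all charts are the identity; `MForm.inChart_apply_extChartAt`). [folklore] -/
theorem inChart_apply_coe {k : ℕ} (α : MForm 𝓙 unitInterval ℝ k) (p x : unitInterval)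
    (v : Fin k → ℝ) : α.inChart p x.val v = α x v := by
  have h := MForm.inChart_apply_extChartAt α (mem_source p x) v
  rw [extChartAt_apply] at h
  rw [h]
  congr 1
  funext i
  exact tangentCoordChange_eq p x (v i)

/-! ### The flat metric and the orientation -/

/-- The Euclidean metric `g_x(u, v) = uv` on the tangent spaces `T_x[0,1] = ℝ`, as a Mathlib
`Bundle.RiemannianMetric` (constant in `x`). [folklore] -/
def metric : Bundle.RiemannianMetric (fun x : unitInterval ↦ TangentSpace 𝓙 x) where
  inner _ := ContinuousLinearMap.mul ℝ ℝ
  symm _ u v := by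
    change @HMul.hMul ℝ ℝ ℝ instHMul u v = @HMul.hMul ℝ ℝ ℝ instHMul v u
    exact mul_comm _ _
  pos _ u hu := mul_self_pos.2 hu
  continuousAt _ := by
    change ContinuousAt (fun u : ℝ ↦ u * u) 0
    fun_prop
  isVonNBounded _ := by
    change Bornology.IsVonNBounded ℝ {u : ℝ | u * u < 1}
    refine (NormedSpace.isVonNBounded_ball ℝ ℝ 1).subset fun u hu ↦ ?_
    rw [Metric.mem_ball, dist_zero_right, Real.norm_eq_abs]
    have hu : u * u < 1 := hu
    nlinarith [abs_mul_abs_self u, abs_nonneg u]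

/-- The flat metric as a `RiemannianBundle` structure: a (reducible) `def`, supplied explicitly to
the fact under refutation and used as a *local* instance below — never a global instance. [folklore] -/
@[reducible]
def bundle : Bundle.RiemannianBundle (fun x : unitInterval ↦ TangentSpace 𝓙 x) := ⟨metric⟩

/-- `finrank ℝ ℝ = 1`, the `Fact` consumed by `Orientation.volumeForm` (a local instance below). [folklore] -/
theorem factFinrank : Fact (finrank ℝ ℝ = 1) := ⟨Module.finrank_self ℝ⟩

/-- The basis `{1}` of `T_x[0,1] = ℝ`. [folklore] -/
def bT (x : unitInterval) : Basis (Fin 1) ℝ (TangentSpace 𝓙 x) := Basis.singleton (Fin 1) ℝ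

/-- The standard orientation of `T_x[0,1] = ℝ` (that of the basis `{1}`). [folklore] -/
def orient (x : unitInterval) : Orientation ℝ (TangentSpace 𝓙 x) (Fin 1) := (bT x).orientation

/-- The determinant of the basis `{1}` is `v ↦ v 0`. [folklore] -/
theorem bT_det (x : unitInterval) (v : Fin 1 → TangentSpace 𝓙 x) : (bT x).det v = v 0 := by
  rw [Basis.det_apply, Matrix.det_unique, Basis.toMatrix_apply]
  exact Basis.singleton_repr _ _ _ _

section WithMetric

open Bundle

attribute [local instance] bundle factFinrank

/-- The inner product of the flat metric on `T_x[0,1]` is multiplication (definitional). [folklore] -/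
theorem inner_eq (x : unitInterval) (u v : TangentSpace 𝓙 x) :
    inner ℝ u v = @HMul.hMul ℝ ℝ ℝ instHMul u v :=
  rfl

/-- `{1}` is orthonormal for the flat metric. [folklore] -/
theorem orthonormal_bT (x : unitInterval) : Orthonormal ℝ (bT x) := by
  rw [orthonormal_iff_ite]
  intro i j
  obtain rfl : i = 0 := Subsingleton.elim _ _
  obtain rfl : j = 0 := Subsingleton.elim _ _
  rw [inner_eq, if_pos rfl]
  have h1 : @Eq ℝ (bT x 0) 1 := Basis.singleton_apply (Fin 1) ℝ 0
  rw [h1]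
  exact mul_one 1

/-- `{1}` as an orthonormal basis of `T_x[0,1]`. [folklore] -/
def obT (x : unitInterval) : OrthonormalBasis (Fin 1) ℝ (TangentSpace 𝓙 x) :=
  (bT x).toOrthonormalBasis (orthonormal_bT x)

/-- The underlying basis of `obT x` is `bT x`. [folklore] -/
theorem toBasis_obT (x : unitInterval) : (obT x).toBasis = bT x :=
  Basis.toBasis_toOrthonormalBasis _ _

/-- The volume form of `T_x[0,1]` is `dt`: `vol(v) = v 0` (`Orientation.volumeForm_robust`). [folklore] -/
theorem volumeForm_apply (x : unitInterval) (v : Fin 1 → TangentSpace 𝓙 x) :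
    (orient x).volumeForm v = v 0 := by
  rw [Orientation.volumeForm_robust (orient x) (obT x) (by rw [toBasis_obT]; rfl), toBasis_obT,
    bT_det]

/-- The Riemannian volume form of `[0,1]` is `dt` at every point. [folklore] -/
theorem riemannianVolumeForm_apply' (x : unitInterval) (v : Fin 1 → TangentSpace 𝓙 x) :
    riemannianVolumeForm orient x v = v 0 := by
  rw [riemannianVolumeForm_apply, Orientation.volumeFormL_apply, volumeForm_apply]

/-! ### Chart signs, continuity of the orientation, smoothness of the volume form -/

/-- The representative `(orient x).someVector` of the orientation has the sign of `dt`: it is a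
positive multiple of the determinant of `{1}`. [folklore] -/
theorem someVector_apply_sign (x : unitInterval) (v : Fin 1 → TangentSpace 𝓙 x) :
    Real.sign ((orient x).someVector v) = Real.sign (v 0) := by
  have h0 : (orient x).someVector ≠ 0 := Module.Ray.someVector_ne_zero _
  have hray : SameRay ℝ (orient x).someVector (bT x).det := by
    rw [← ray_eq_iff (R := ℝ) h0 (bT x).det_ne_zero, Module.Ray.someVector_ray]
    rfl
  obtain ⟨c, hc, hcv⟩ := hray.exists_pos_left h0 (bT x).det_ne_zero
  have : (orient x).someVector v = c⁻¹ * (bT x).det v := by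
    rw [← hcv, AlternatingMap.smul_apply, smul_eq_mul, ← mul_assoc, inv_mul_cancel₀ hc.ne',
      one_mul]
  rw [this, real_sign_mul, Real.sign_of_pos (inv_pos.2 hc), one_mul, bT_det]

/-- **The chart sign is constant on `[0,1]`**: it is the sign of the (unknown, nonzero) reference
basis vector `modelBasis ℝ 1 0`. [folklore] -/
theorem chartSign_apply_coe (p x : unitInterval) :
    chartSign orient p x.val = Real.sign (modelBasis ℝ 1 0) := by
  rw [chartSign_eq_sign_orientationForm, ← extChartAt_apply p x,
    mfderivWithin_extChartAt_symm_apply_eq (mem_source p x), PartialEquiv.left_inv _ (mem_source p x)]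
  refine Eq.trans ?_ (someVector_apply_sign x (fun j ↦ (modelBasis ℝ 1 j : ℝ)))
  show Real.sign ((orient x).someVector _) = _
  congr 2
  funext j
  exact tangentCoordChange_eq p x _

/-- The chart sign does not vanish on `[0,1]`. [folklore] -/
theorem chartSign_ne_zero (p x : unitInterval) : chartSign orient p x.val ≠ 0 := by
  rw [chartSign_apply_coe]
  intro h
  exact (modelBasis ℝ 1).ne_zero 0 (Real.sign_eq_zero_iff.1 h)

/-- The orientation family `orient` is continuous (`(M, o)` is an oriented manifold with boundary). [folklore] -/
theorem isContinuousOrientation : IsContinuousOrientation orient := by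
  intro x₀
  have hmem : Icc (0 : ℝ) 1 ∈ 𝓝[range 𝓙] (extChartAt 𝓙 x₀ x₀) := by
    rw [range_𝓙]; exact self_mem_nhdsWithin
  filter_upwards [hmem] with y hy
  rw [extChartAt_apply, show y = (⟨y, hy⟩ : unitInterval).val from rfl, chartSign_apply_coe,
    chartSign_apply_coe]
  exact ⟨rfl, chartSign_apply_coe x₀ ⟨y, hy⟩ ▸ chartSign_ne_zero x₀ ⟨y, hy⟩⟩

/-- The model `1`-form `dt` on `ℝ`. [folklore] -/
def dt : ℝ [⋀^Fin 1]→L[ℝ] ℝ := ofSubsingleton ℝ ℝ ℝ (0 : Fin 1) (ContinuousLinearMap.id ℝ ℝ)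

/-- `dt(v) = v 0`. [folklore] -/
@[simp] theorem dt_apply (v : Fin 1 → ℝ) : dt v = v 0 := rfl

/-- The chart representative of the volume form is the constant form `dt` on `[0,1]`. [folklore] -/
theorem inChart_riemannianVolumeForm {y : ℝ} (hy : y ∈ Icc (0 : ℝ) 1) (p : unitInterval) :
    (riemannianVolumeForm orient).inChart p y = dt := by
  refine ContinuousAlternatingMap.ext fun v ↦ ?_
  rw [show y = (⟨y, hy⟩ : unitInterval).val from rfl, inChart_apply_coe, dt_apply]
  exact riemannianVolumeForm_apply' _ _

/-- **The hypothesis `ho` of the fact holds**: the volume form `dt` of `[0,1]` is smooth. [folklore] -/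
theorem isSmoothForm_riemannianVolumeForm : IsSmoothForm (riemannianVolumeForm orient) := by
  intro x
  rw [range_𝓙, extChartAt_apply]
  exact (contDiffWithinAt_const (c := dt)).congr (fun y hy ↦ inChart_riemannianVolumeForm hy x)
    (inChart_riemannianVolumeForm x.2 x)

/-! ### `0`-forms and `1`-forms on `[0,1]` as functions -/

/-- The `0`-form attached to a function `f : ℝ → ℝ` (sampled on `[0,1]`). [folklore] -/
def zf (f : ℝ → ℝ) : MForm 𝓙 unitInterval ℝ 0 :=
  fun x ↦ constOfIsEmpty ℝ (TangentSpace 𝓙 x) (Fin 0) (f x.val)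

/-- The `1`-form `g dt` attached to a function `g : ℝ → ℝ`. [folklore] -/
def of (g : ℝ → ℝ) : MForm 𝓙 unitInterval ℝ 1 := fun x ↦ g x.val • riemannianVolumeForm orient x

/-- The scalar function of a `0`-form, extended from `[0,1]` to `ℝ` by `projIcc`. [folklore] -/
def fn (η : MForm 𝓙 unitInterval ℝ 0) : ℝ → ℝ := fun y ↦ η (Set.projIcc 0 1 zero_le_one y) ![]

/-- Values of `zf f`. [folklore] -/
@[simp] theorem zf_apply (f : ℝ → ℝ) (x : unitInterval) (v : Fin 0 → TangentSpace 𝓙 x) :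
    zf f x v = f x.val := rfl

/-- Values of `g dt`. [folklore] -/
@[simp] theorem of_apply (g : ℝ → ℝ) (x : unitInterval) (v : Fin 1 → ℝ) :
    of g x v = g x.val * v 0 := by
  show (g x.val • riemannianVolumeForm orient x) v = _
  rw [ContinuousAlternatingMap.smul_apply, riemannianVolumeForm_apply', smul_eq_mul]

/-- On `[0,1]` the scalar function of `η` is the value of `η`. [folklore] -/
theorem fn_coe (η : MForm 𝓙 unitInterval ℝ 0) (x : unitInterval) : fn η x.val = η x ![] := by
  rw [fn, Set.projIcc_val]

/-- On `[0,1]` the scalar function of `η` is the value of `η`. [folklore] -/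
theorem fn_of_mem (η : MForm 𝓙 unitInterval ℝ 0) {y : ℝ} (hy : y ∈ Icc (0 : ℝ) 1) :
    fn η y = η ⟨y, hy⟩ ![] :=
  fn_coe η ⟨y, hy⟩

/-- A `0`-form is its scalar function (there is only one `0`-tuple of vectors). [folklore] -/
theorem apply_eq_fn (η : MForm 𝓙 unitInterval ℝ 0) (x : unitInterval)
    (v : Fin 0 → TangentSpace 𝓙 x) : η x v = fn η x.val := by
  rw [fn_coe, Subsingleton.elim v ![]]

/-- The scalar function of `zf f` is `f` on `[0,1]`. [folklore] -/
theorem fn_zf {f : ℝ → ℝ} {y : ℝ} (hy : y ∈ Icc (0 : ℝ) 1) : fn (zf f) y = f y := by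
  rw [fn_of_mem _ hy, zf_apply]

/-- The scalar function of `zf f` is `f` on `[0,1]`. [folklore] -/
theorem fn_zf_eqOn (f : ℝ → ℝ) : EqOn (fn (zf f)) f (Icc 0 1) := fun _ hy ↦ fn_zf hy

/-- `fn` is additive. [folklore] -/
theorem fn_add (β γ : MForm 𝓙 unitInterval ℝ 0) : fn (β + γ) = fn β + fn γ := rfl

/-- `fn` commutes with scalars. [folklore] -/
theorem fn_smul (c : ℝ) (β : MForm 𝓙 unitInterval ℝ 0) : fn (c • β) = c • fn β := rfl

/-- `zf` is additive. [folklore] -/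
theorem zf_add (f g : ℝ → ℝ) : zf (f + g) = zf f + zf g := by
  funext x; refine ContinuousAlternatingMap.ext fun v ↦ ?_; rfl

/-- `zf` commutes with scalars. [folklore] -/
theorem zf_smul (c : ℝ) (f : ℝ → ℝ) : zf (c • f) = c • zf f := by
  funext x; refine ContinuousAlternatingMap.ext fun v ↦ ?_; rfl

/-- `zf f` only depends on `f` restricted to `[0,1]`. [folklore] -/
theorem zf_congr {f g : ℝ → ℝ} (h : EqOn f g (Icc 0 1)) : zf f = zf g := by
  funext x; refine ContinuousAlternatingMap.ext fun v ↦ ?_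
  rw [zf_apply, zf_apply, h x.2]

/-- Chart representatives of a `0`-form on `[0,1]`: the constant-in-the-fibre form `fn η`. [folklore] -/
theorem inChart_zeroForm (η : MForm 𝓙 unitInterval ℝ 0) {y : ℝ} (hy : y ∈ Icc (0 : ℝ) 1)
    (p : unitInterval) : η.inChart p y = constOfIsEmpty ℝ ℝ (Fin 0) (fn η y) := by
  refine ContinuousAlternatingMap.ext fun v ↦ ?_
  rw [show y = (⟨y, hy⟩ : unitInterval).val from rfl, inChart_apply_coe, constOfIsEmpty_apply,
    apply_eq_fn]

/-- Chart representatives of the `1`-form `g dt`. [folklore] -/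
theorem inChart_of (g : ℝ → ℝ) {y : ℝ} (hy : y ∈ Icc (0 : ℝ) 1) (p : unitInterval) :
    (of g).inChart p y = g y • dt := by
  refine ContinuousAlternatingMap.ext fun v ↦ ?_
  rw [show y = (⟨y, hy⟩ : unitInterval).val from rfl, inChart_apply_coe, of_apply]
  rfl

/-- **Smoothness of a `0`-form on `[0,1]` is smoothness of its scalar function on `[0,1]`**
(chart-wise `C^∞` within `range 𝓙 = [0,1]`, i.e. with one-sided derivatives at the end points). [folklore] -/
theorem isSmoothForm_iff_fn (η : MForm 𝓙 unitInterval ℝ 0) :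
    IsSmoothForm η ↔ ContDiffOn ℝ ∞ (fn η) (Icc 0 1) := by
  constructor
  · intro hη y hy
    have h := hη ⟨y, hy⟩
    rw [range_𝓙, extChartAt_apply] at h
    have h2 := (ContinuousAlternatingMap.apply ℝ ℝ ℝ (![] : Fin 0 → ℝ)).contDiff.comp_contDiffWithinAt h
    refine h2.congr (fun z hz ↦ ?_) ?_
    · show fn η z = η.inChart ⟨y, hy⟩ z ![]
      rw [inChart_zeroForm η hz, constOfIsEmpty_apply]
    · show fn η y = η.inChart ⟨y, hy⟩ y ![]
      rw [inChart_zeroForm η hy, constOfIsEmpty_apply]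
  · intro hf x
    rw [range_𝓙, extChartAt_apply]
    have h2 := (constOfIsEmptyLIE ℝ ℝ ℝ (Fin 0)).contDiff.comp_contDiffWithinAt (hf x.val x.2)
    refine h2.congr (fun z hz ↦ ?_) ?_
    · rw [inChart_zeroForm η hz]; rfl
    · rw [inChart_zeroForm η x.2]; rfl

/-- `zf f` is smooth for `f` smooth on `[0,1]`. [folklore] -/
theorem isSmoothForm_zf {f : ℝ → ℝ} (hf : ContDiffOn ℝ ∞ f (Icc 0 1)) : IsSmoothForm (zf f) :=
  (isSmoothForm_iff_fn _).2 (hf.congr (fn_zf_eqOn f))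

/-- The scalar function of a smooth `0`-form is smooth on `[0,1]`. [folklore] -/
theorem contDiffOn_fn {η : MForm 𝓙 unitInterval ℝ 0} (hη : IsSmoothForm η) :
    ContDiffOn ℝ ∞ (fn η) (Icc 0 1) :=
  (isSmoothForm_iff_fn η).1 hη

/-- `g dt` is smooth for `g` smooth on `[0,1]`. [folklore] -/
theorem isSmoothForm_of {g : ℝ → ℝ} (hg : ContDiffOn ℝ ∞ g (Icc 0 1)) : IsSmoothForm (of g) := by
  intro x
  rw [range_𝓙, extChartAt_apply]
  exact ((hg x.val x.2).smul (contDiffWithinAt_const (c := dt))).congr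
    (fun z hz ↦ inChart_of g hz x) (inChart_of g x.2 x)

/-! ### `d`, `⋆` and `Δ` on `0`-forms of `[0,1]` -/

/-- The derivative within `[0,1]` (one-sided at the end points). [folklore] -/
abbrev D (f : ℝ → ℝ) : ℝ → ℝ := derivWithin f (Icc 0 1)

/-- `D f` on `[0,1]` only depends on `f` restricted to `[0,1]`. [folklore] -/
theorem D_congr {f g : ℝ → ℝ} (h : EqOn f g (Icc 0 1)) : EqOn (D f) (D g) (Icc 0 1) :=
  fun _ hy ↦ derivWithin_congr h (h hy)

/-- The manifold exterior derivative on `[0,1]` is Mathlib's `extDerivWithin` (within `[0,1]`)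
of the chart representative (`mfderiv_extChartAt_self`). [folklore] -/
theorem mextDeriv_apply_eq {k : ℕ} (α : MForm 𝓙 unitInterval ℝ k) (x : unitInterval)
    (v : Fin (k + 1) → ℝ) : mextDeriv α x v = extDerivWithin (α.inChart x) (Icc 0 1) x.val v := by
  rw [← range_𝓙]
  show extDerivWithin (α.inChart x) (range 𝓙) (extChartAt 𝓙 x x)
    (mfderiv 𝓙 𝓘(ℝ, ℝ) (extChartAt 𝓙 x) x ∘ v) = _
  rw [mfderiv_extChartAt_self]
  rfl

/-- **`dη = (fn η)′ dt`** for a `0`-form on `[0,1]` (Mathlib's `extDerivWithin_constOfIsEmpty`);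
no differentiability hypothesis (`derivWithin` carries the junk value). [folklore] -/
theorem mextDeriv_zeroForm_apply (η : MForm 𝓙 unitInterval ℝ 0) (x : unitInterval)
    (v : Fin 1 → ℝ) : mextDeriv η x v = D (fn η) x.val * v 0 := by
  rw [mextDeriv_apply_eq, extDerivWithin_congr' (fun z hz ↦ inChart_zeroForm η hz x) x.2,
    extDerivWithin_constOfIsEmpty _ (uniqueDiffOn_Icc_zero_one _ x.2),
    ofSubsingleton_apply_apply,
    show fderivWithin ℝ (fn η) (Icc 0 1) x.val (v 0) = v 0 • fderivWithin ℝ (fn η) (Icc 0 1) x.val 1 by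
      rw [← ContinuousLinearMap.map_smul, smul_eq_mul, mul_one],
    fderivWithin_derivWithin, smul_eq_mul, mul_comm]

/-- `dη = (fn η)′ dt` as forms. [folklore] -/
theorem mextDeriv_zeroForm (η : MForm 𝓙 unitInterval ℝ 0) : mextDeriv η = of (D (fn η)) := by
  funext x
  refine ContinuousAlternatingMap.ext fun v ↦ ?_
  rw [of_apply]
  exact mextDeriv_zeroForm_apply η x v

/-- **`⋆(g dt) = g`** (`hodgeStar_volumeFormL_holds : ⋆vol = 1`, pointwise). [folklore] -/
theorem hodgeStar_of (h : 1 + 0 = 1) (g : ℝ → ℝ) : MForm.hodgeStar orient h (of g) = zf g := by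
  funext x
  rw [MForm.hodgeStar_apply]
  change hodgeStar (orient x) h (g x.val • (orient x).volumeFormL) = _
  rw [map_smul, hodgeStar_volumeFormL_holds (orient x) h]
  refine ContinuousAlternatingMap.ext fun v ↦ ?_
  simp [zf]

/-- **The Hodge Laplacian of a `0`-form on `[0,1]` is `-(fn η)″`**, `Δ = δd = -⋆d⋆d`, with
within-`[0,1]` derivatives; valid for *every* `0`-form (no smoothness needed). [folklore] -/
theorem hodgeLaplacian_zeroForm (h : 0 + 1 = 1) (η : MForm 𝓙 unitInterval ℝ 0) :
    hodgeLaplacian orient 0 1 h η = zf (-(D (D (fn η)))) := by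
  simp only [hodgeLaplacian, mcoderiv]
  rw [mextDeriv_zeroForm η, hodgeStar_of, mextDeriv_zeroForm, hodgeStar_of,
    zf_congr (D_congr (fn_zf_eqOn _)), ← zf_smul]
  congr 1
  funext y
  simp

/-! ### Smooth `0`-forms: linearity of `Δ`, harmonic forms are affine -/

/-- `∞ + 1 ≤ ∞` in `WithTop ℕ∞`. [folklore] -/
theorem infty_add_one_le : (∞ : WithTop ℕ∞) + 1 ≤ ∞ := le_of_eq (by norm_cast)

/-- The within-`[0,1]` derivative of a smooth function is smooth on `[0,1]`. [folklore] -/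
theorem contDiffOn_D {f : ℝ → ℝ} (hf : ContDiffOn ℝ ∞ f (Icc 0 1)) : ContDiffOn ℝ ∞ (D f) (Icc 0 1) :=
  hf.derivWithin uniqueDiffOn_Icc_zero_one infty_add_one_le

/-- Smooth on `[0,1]` implies differentiable on `[0,1]`. [folklore] -/
theorem differentiableOn_of_contDiffOn {f : ℝ → ℝ} (hf : ContDiffOn ℝ ∞ f (Icc 0 1)) :
    DifferentiableOn ℝ f (Icc 0 1) :=
  hf.differentiableOn (by simp)

/-- `D` is additive on differentiable functions (on `[0,1]`). [folklore] -/
theorem D_add {f g : ℝ → ℝ} (hf : DifferentiableOn ℝ f (Icc 0 1))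
    (hg : DifferentiableOn ℝ g (Icc 0 1)) : EqOn (D (f + g)) (D f + D g) (Icc 0 1) :=
  fun y hy ↦ derivWithin_add (hf y hy) (hg y hy)

/-- `D` commutes with scalars on differentiable functions (on `[0,1]`). [folklore] -/
theorem D_smul (c : ℝ) {f : ℝ → ℝ} (hf : DifferentiableOn ℝ f (Icc 0 1)) :
    EqOn (D (c • f)) (c • D f) (Icc 0 1) :=
  fun y hy ↦ derivWithin_const_smul c (hf y hy)

/-- `D` of a constant vanishes. [folklore] -/
theorem D_const (c : ℝ) : D (fun _ ↦ c) = 0 := derivWithin_fun_const _ _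

/-- `Δ` is additive on smooth `0`-forms of `[0,1]`. [folklore] -/
theorem hodgeLaplacian_add (h : 0 + 1 = 1) {β γ : MForm 𝓙 unitInterval ℝ 0} (hβ : IsSmoothForm β)
    (hγ : IsSmoothForm γ) : hodgeLaplacian orient 0 1 h (β + γ) =
      hodgeLaplacian orient 0 1 h β + hodgeLaplacian orient 0 1 h γ := by
  rw [hodgeLaplacian_zeroForm, hodgeLaplacian_zeroForm, hodgeLaplacian_zeroForm, ← zf_add]
  refine zf_congr fun y hy ↦ ?_
  have hb := contDiffOn_fn hβ
  have hg := contDiffOn_fn hγ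
  have h1 : EqOn (D (fn (β + γ))) (D (fn β) + D (fn γ)) (Icc 0 1) := by
    rw [fn_add]
    exact D_add (differentiableOn_of_contDiffOn hb) (differentiableOn_of_contDiffOn hg)
  simp only [Pi.neg_apply, Pi.add_apply]
  rw [D_congr h1 hy, D_add (differentiableOn_of_contDiffOn (contDiffOn_D hb))
    (differentiableOn_of_contDiffOn (contDiffOn_D hg)) hy, Pi.add_apply, neg_add]

/-- `Δ` commutes with scalars on smooth `0`-forms of `[0,1]`. [folklore] -/
theorem hodgeLaplacian_smul (h : 0 + 1 = 1) (c : ℝ) {β : MForm 𝓙 unitInterval ℝ 0}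
    (hβ : IsSmoothForm β) :
    hodgeLaplacian orient 0 1 h (c • β) = c • hodgeLaplacian orient 0 1 h β := by
  rw [hodgeLaplacian_zeroForm, hodgeLaplacian_zeroForm, ← zf_smul]
  refine zf_congr fun y hy ↦ ?_
  have hb := contDiffOn_fn hβ
  have h1 : EqOn (D (fn (c • β))) (c • D (fn β)) (Icc 0 1) := by
    rw [fn_smul]
    exact D_smul c (differentiableOn_of_contDiffOn hb)
  simp only [Pi.neg_apply, Pi.smul_apply, smul_eq_mul]
  rw [D_congr h1 hy, D_smul c (differentiableOn_of_contDiffOn (contDiffOn_D hb)) hy, Pi.smul_apply,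
    smul_eq_mul, mul_neg]

/-- Constant `0`-forms on `[0,1]` are harmonic. [folklore] -/
theorem isHarmonicForm_zf_const (h : 0 + 1 = 1) (c : ℝ) :
    IsHarmonicForm orient h (zf fun _ ↦ c) := by
  refine ⟨isSmoothForm_zf contDiffOn_const, ?_⟩
  rw [hodgeLaplacian_zeroForm]
  have h1 : EqOn (D (fn (zf fun _ ↦ c))) 0 (Icc 0 1) := fun y hy ↦ by
    rw [D_congr (fn_zf_eqOn _) hy, D_const]
  funext x
  refine ContinuousAlternatingMap.ext fun v ↦ ?_
  rw [zf_apply, Pi.neg_apply, D_congr h1 x.2, show D (0 : ℝ → ℝ) = 0 from D_const 0]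
  simp

/-- **Harmonic `0`-forms on `[0,1]` are affine**: `Δη = 0` means `(fn η)″ = 0` on `[0,1]`, so
`fn η (y) = fn η (0) + (fn η)′(0) · y` (twice `constant_of_derivWithin_zero`). [folklore] -/
theorem fn_eq_of_isHarmonicForm (h : 0 + 1 = 1) {η : MForm 𝓙 unitInterval ℝ 0}
    (hη : IsHarmonicForm orient h η) {y : ℝ} (hy : y ∈ Icc (0 : ℝ) 1) :
    fn η y = fn η 0 + D (fn η) 0 * y := by
  have hs := contDiffOn_fn hη.1
  have hd : DifferentiableOn ℝ (fn η) (Icc 0 1) := differentiableOn_of_contDiffOn hs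
  have hd' : DifferentiableOn ℝ (D (fn η)) (Icc 0 1) := differentiableOn_of_contDiffOn (contDiffOn_D hs)
  have hΔ : ∀ z ∈ Icc (0 : ℝ) 1, D (D (fn η)) z = 0 := fun z hz ↦ by
    have := congrFun hη.2 ⟨z, hz⟩
    rw [hodgeLaplacian_zeroForm] at this
    have h0 := DFunLike.congr_fun this ![]
    rw [zf_apply] at h0
    simpa using h0
  -- `D (fn η)` is constant
  have hc : ∀ z ∈ Icc (0 : ℝ) 1, D (fn η) z = D (fn η) 0 :=
    constant_of_derivWithin_zero hd' fun z hz ↦ hΔ z (Ico_subset_Icc_self hz)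
  -- hence `fn η - D (fn η) 0 · id` is constant
  set b := D (fn η) 0
  have hφd : DifferentiableOn ℝ (fun z ↦ fn η z - b * z) (Icc 0 1) :=
    hd.sub (fun z hz ↦ ((differentiableWithinAt_id (𝕜 := ℝ) (s := Icc (0 : ℝ) 1) (x := z)).const_mul b))
  have hφ : ∀ z ∈ Icc (0 : ℝ) 1, fn η z - b * z = fn η 0 - b * 0 := by
    refine constant_of_derivWithin_zero hφd fun z hz ↦ ?_
    have hz' : z ∈ Icc (0 : ℝ) 1 := Ico_subset_Icc_self hz
    have hu : UniqueDiffWithinAt ℝ (Icc (0 : ℝ) 1) z := uniqueDiffOn_Icc_zero_one z hz'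
    have h1 := ((hd z hz').hasDerivWithinAt).sub ((hasDerivWithinAt_id z (Icc (0 : ℝ) 1)).const_mul b)
    simp only [id_eq] at h1
    rw [show (fun z ↦ fn η z - b * z) = (fn η - fun y ↦ b * y) from rfl, h1.derivWithin hu]
    change D (fn η) z - b * 1 = 0
    rw [hc z hz', mul_one, sub_self]
  have := hφ y hy
  rw [mul_zero, sub_zero] at this
  linarith

/-- **Every element of `harmonicForms` (the span of the harmonic `0`-forms of `[0,1]`) is smooth
and affine** (`Submodule.span_induction`). [folklore] -/
theorem isAff_of_mem_harmonicForms (h : 0 + 1 = 1) {η : MForm 𝓙 unitInterval ℝ 0}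
    (hη : η ∈ harmonicForms orient h) :
    IsSmoothForm η ∧ ∃ a b : ℝ, ∀ y ∈ Icc (0 : ℝ) 1, fn η y = a + b * y := by
  induction hη using Submodule.span_induction with
  | mem η hη => exact ⟨hη.1, fn η 0, D (fn η) 0, fun y hy ↦ fn_eq_of_isHarmonicForm h hη hy⟩
  | zero => exact ⟨isSmoothForm_zero, 0, 0, fun y _ ↦ by simp [fn]⟩
  | add β γ _ _ hβ hγ =>
    obtain ⟨hβs, a, b, hab⟩ := hβ
    obtain ⟨hγs, a', b', hab'⟩ := hγ
    exact ⟨hβs.add hγs, a + a', b + b', fun y hy ↦ by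
      rw [fn_add, Pi.add_apply, hab y hy, hab' y hy]; ring⟩
  | smul c β _ hβ =>
    obtain ⟨hβs, a, b, hab⟩ := hβ
    exact ⟨hβs.smul c, c * a, c * b, fun y hy ↦ by
      rw [fn_smul, Pi.smul_apply, hab y hy, smul_eq_mul]; ring⟩

/-! ### The `L²` inner product of `0`-forms on `[0,1]` -/

/-- There is exactly one `0`-element multi-index in `Fin 1`. [folklore] -/
theorem card_powersetCard_one_zero : Fintype.card (Set.powersetCard (Fin 1) 0) = 1 :=
  Fintype.card_eq_one_iff.2 ⟨⟨∅, by simp⟩, fun s ↦ Subtype.ext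
    (Finset.card_eq_zero.1 (Set.powersetCard.mem_iff.1 s.2))⟩

/-- The pointwise inner product of two `0`-forms is the product of their values. [folklore] -/
theorem inner_zeroForm (β η : MForm 𝓙 unitInterval ℝ 0) (x : unitInterval) :
    MForm.inner 1 β η x = fn β x.val * fn η x.val := by
  rw [MForm.inner, alternatingFormInner_apply]
  simp_rw [apply_eq_fn]
  rw [Finset.sum_const, Finset.card_univ, card_powersetCard_one_zero, one_smul]

/-- The integrand of `⟪β, η⟫_{L²}` for `0`-forms is `(fn β · fn η) dt`. [folklore] -/
theorem inner_smul_riemannianVolumeForm_eq_of (β η : MForm 𝓙 unitInterval ℝ 0) :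
    (fun x ↦ MForm.inner 1 β η x • riemannianVolumeForm orient x) =
      of (fun t ↦ fn β t * fn η t) := by
  funext x
  rw [inner_zeroForm]
  rfl

/-- The base point `0 ∈ [0,1]`. [folklore] -/
def pt : unitInterval := ⟨0, le_rfl, zero_le_one⟩

/-- The one-function partition of unity `{1}` on `[0,1]` (subordinate to the single chart). [folklore] -/
def triv : SmoothPartitionOfUnity Unit 𝓙 unitInterval univ where
  toFun _ := ⟨fun _ ↦ 1, contMDiff_const⟩
  locallyFinite' := locallyFinite_of_finite _
  nonneg' _ _ := zero_le_one
  sum_eq_one' x _ := by rw [finsum_unique]; rfl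
  sum_le_one' x := by rw [finsum_unique]; exact le_of_eq rfl

/-- The function of `triv` is `1`. [folklore] -/
theorem triv_apply (i : Unit) (x : unitInterval) : triv i x = 1 := rfl

/-- `triv` is subordinate to the (unique, global) chart source. [folklore] -/
theorem triv_isSubordinate : triv.IsSubordinate fun _ ↦ (chartAt unitInterval pt).source := by
  intro i
  rw [chartAt_self_eq]
  exact subset_univ _

/-- The normalising constant relating `∫_{[0,1]}` — computed, as `MForm.integral` prescribes,
through chart signs, the reference basis `e = modelBasis ℝ 1` and its Haar measure — to the
interval integral: `sign (e 0) · e 0 · (e.addHaar / volume)`. Its value is irrelevant below. [folklore] -/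
def K : ℝ :=
  Real.sign (modelBasis ℝ 1 0) * modelBasis ℝ 1 0 * ((modelBasis ℝ 1).addHaar.addHaarScalarFactor volume : ℝ)

/-- **`∫_{[0,1]} F dt = K ∫₀¹ F`** for `F` smooth on `[0,1]`: the integral of the discharged fact
`MForm.integralPU_eq_integral_holds` computed with the partition of unity `{1}`, the chart sign
being constant on `[0,1]` and the Haar measure of the reference basis a multiple of Lebesgue
measure (`Measure.isAddLeftInvariant_eq_smul`). [folklore] -/
theorem integral_of {F : ℝ → ℝ} (hF : ContDiffOn ℝ ∞ F (Icc 0 1)) :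
    MForm.integral orient (of F) = K * ∫ t in (0 : ℝ)..1, F t := by
  rw [← MForm.integralPU_eq_integral_holds orient triv (fun _ ↦ pt) triv_isSubordinate
    isContinuousOrientation (isSmoothForm_of hF), MForm.integralPU, finsum_unique,
    extChartAt_target']
  have hcongr : ∀ y ∈ Icc (0 : ℝ) 1, chartSign orient pt y * triv default ((extChartAt 𝓙 pt).symm y) *
      (of F).inChart pt y (modelBasis ℝ 1) =
        (Real.sign (modelBasis ℝ 1 0) * modelBasis ℝ 1 0) * F y := by
    intro y hy
    rw [triv_apply, mul_one, show y = (⟨y, hy⟩ : unitInterval).val from rfl, chartSign_apply_coe,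
      inChart_apply_coe, of_apply]
    ring
  rw [setIntegral_congr_fun measurableSet_Icc hcongr, integral_const_mul,
    MeasureTheory.Measure.isAddLeftInvariant_eq_smul (modelBasis ℝ 1).addHaar volume,
    Measure.restrict_smul, integral_smul_nnreal_measure, integral_Icc_eq_integral_Ioc,
    ← intervalIntegral.integral_of_le zero_le_one, K, NNReal.smul_def, smul_eq_mul]
  ring

/-- **`⟪β, η⟫_{L²} = K ∫₀¹ fn β · fn η`** for smooth `0`-forms on `[0,1]`. [folklore] -/
theorem l2Inner_eq {β η : MForm 𝓙 unitInterval ℝ 0} (hβ : IsSmoothForm β) (hη : IsSmoothForm η) :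
    MForm.l2Inner orient β η = K * ∫ t in (0 : ℝ)..1, fn β t * fn η t := by
  rw [MForm.l2Inner, inner_smul_riemannianVolumeForm_eq_of,
    integral_of ((contDiffOn_fn hβ).mul (contDiffOn_fn hη))]

/-! ### The perturbation `p = 6t² - 6t + 1` -/

/-- `p(t) = 6t² - 6t + 1`: a polynomial `L²[0,1]`-orthogonal to the affine functions, with `p″`
constant (`p = q″` for `q = t²(1 - t)²/2`, which vanishes to second order at both ends). [folklore] -/
def pfun (t : ℝ) : ℝ := 6 * t ^ 2 - 6 * t + 1

/-- `p` is smooth. [folklore] -/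
theorem contDiff_pfun : ContDiff ℝ ∞ pfun := by unfold pfun; fun_prop

/-- `p` is continuous. [folklore] -/
theorem continuous_pfun : Continuous pfun := by unfold pfun; fun_prop

/-- `p′(t) = 12t - 6`. [folklore] -/
theorem hasDerivAt_pfun (t : ℝ) : HasDerivAt pfun (12 * t - 6) t := by
  have h := (((hasDerivAt_pow 2 t).const_mul 6).sub ((hasDerivAt_id' (x := t)).const_mul 6)).add_const 1
  refine h.congr_deriv ?_
  push_cast
  ring

/-- `D p = 12t - 6` on `[0,1]`. [folklore] -/
theorem D_pfun {y : ℝ} (hy : y ∈ Icc (0 : ℝ) 1) : D pfun y = 12 * y - 6 :=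
  (hasDerivAt_pfun y).hasDerivWithinAt.derivWithin (uniqueDiffOn_Icc_zero_one y hy)

/-- `D (D p) = 12` on `[0,1]`. [folklore] -/
theorem D_D_pfun {y : ℝ} (hy : y ∈ Icc (0 : ℝ) 1) : D (D pfun) y = 12 := by
  rw [D_congr (f := D pfun) (g := fun t ↦ 12 * t - 6) (fun z hz ↦ D_pfun hz) hy]
  have h := ((hasDerivAt_id' (x := y)).const_mul 12).sub_const 6
  rw [mul_one] at h
  exact h.hasDerivWithinAt.derivWithin (uniqueDiffOn_Icc_zero_one y hy)

/-- `Δ p = -p″ = -12` on `[0,1]`. [folklore] -/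
theorem hodgeLaplacian_zf_pfun (h : 0 + 1 = 1) :
    hodgeLaplacian orient 0 1 h (zf pfun) = zf (fun _ ↦ -12) := by
  rw [hodgeLaplacian_zeroForm]
  refine zf_congr fun y hy ↦ ?_
  rw [Pi.neg_apply, D_congr (D_congr (fn_zf_eqOn pfun)) hy, D_D_pfun hy]

/-- **`∫₀¹ p(t) (a + bt) dt = 0`**: `p ⟂ {1, t}` in `L²[0,1]` (fundamental theorem of calculus
with the explicit antiderivative). [folklore] -/
theorem integral_pfun_mul_affine (a b : ℝ) : ∫ t in (0 : ℝ)..1, pfun t * (a + b * t) = 0 := by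
  have hderiv : ∀ t ∈ uIcc (0 : ℝ) 1, HasDerivAt (fun t ↦ b * (3 / 2) * t ^ 4 +
      (2 * a - 2 * b) * t ^ 3 + ((b - 6 * a) / 2) * t ^ 2 + a * t) (pfun t * (a + b * t)) t := by
    intro t _
    have h := ((((hasDerivAt_pow 4 t).const_mul (b * (3 / 2))).add
      ((hasDerivAt_pow 3 t).const_mul (2 * a - 2 * b))).add
      ((hasDerivAt_pow 2 t).const_mul ((b - 6 * a) / 2))).add ((hasDerivAt_id' (x := t)).const_mul a)
    refine h.congr_deriv ?_
    simp only [pfun]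
    push_cast
    ring
  rw [intervalIntegral.integral_eq_sub_of_hasDerivAt hderiv
    ((continuous_pfun.mul (by fun_prop)).intervalIntegrable 0 1)]
  ring

/-! ### The refutation -/

-- names the `@[deprecated]` record `existsUnique_greenOperator` on purpose (verdict clean-up 2026-08-15); REMOVE-WHEN the
-- record is deleted from `L2HodgeTheory.lean`
set_option linter.deprecated false in
/-- **The named fact `existsUnique_greenOperator` is false as stated.** On the compact oriented
Riemannian manifold-with-boundary `[0,1]` (model `𝓙`, flat metric, standard orientation,
`k = 0`, `m = n = 1`, hypothesis `ho` satisfied): if `G` has the Green property then so does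
`G + L` with `L α = α(0) · p`, `p = 6t² - 6t + 1` — `⟪c p, η⟫ = cK ∫₀¹ p (a + bt) = 0` for
`η = a + bt ∈ harmonicForms` (`isAff_of_mem_harmonicForms`, `l2Inner_eq`,
`integral_pfun_mul_affine`) and `Δ(c p) = -12c` is harmonic — while `L 1 = p ≠ 0`; so the Green
operator is not unique and the `∃!` fails. Warner's 6.9–6.10 is about *closed* manifolds. [folklore] -/
theorem not_existsUnique_greenOperator_unitInterval :
    ¬ existsUnique_greenOperator (I := 𝓙) (M := unitInterval) (k := 0) (m := 1) orient := by
  intro H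
  obtain ⟨G, hG, huniq⟩ := H isSmoothForm_riemannianVolumeForm (zero_add 1)
  have hPs : IsSmoothForm (zf pfun) := isSmoothForm_zf contDiff_pfun.contDiffOn
  let P : smoothForms 𝓙 unitInterval ℝ 0 := ⟨zf pfun, hPs⟩
  let ev : smoothForms 𝓙 unitInterval ℝ 0 →ₗ[ℝ] ℝ :=
    { toFun := fun α ↦ fn (α : MForm 𝓙 unitInterval ℝ 0) 0
      map_add' := fun _ _ ↦ rfl
      map_smul' := fun _ _ ↦ rfl }
  let L : smoothForms 𝓙 unitInterval ℝ 0 →ₗ[ℝ] smoothForms 𝓙 unitInterval ℝ 0 := ev.smulRight P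
  have hL : ∀ α, ((G + L) α : MForm 𝓙 unitInterval ℝ 0) =
      (G α : MForm 𝓙 unitInterval ℝ 0) + fn (α : MForm 𝓙 unitInterval ℝ 0) 0 • zf pfun :=
    fun _ ↦ rfl
  have h01 : (0 : ℝ) ∈ Icc (0 : ℝ) 1 := ⟨le_rfl, zero_le_one⟩
  -- `L 1 = p ≠ 0`, so `G + L ≠ G`
  have hne : G + L ≠ G := by
    intro hGL
    let one : smoothForms 𝓙 unitInterval ℝ 0 := ⟨zf fun _ ↦ 1, isSmoothForm_zf contDiffOn_const⟩
    have h1 := congrArg (fun T : smoothForms 𝓙 unitInterval ℝ 0 →ₗ[ℝ] smoothForms 𝓙 unitInterval ℝ 0 ↦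
      fn ((T one : smoothForms 𝓙 unitInterval ℝ 0) : MForm 𝓙 unitInterval ℝ 0) 0) hGL
    rw [hL, fn_add, fn_smul, Pi.add_apply, Pi.smul_apply, smul_eq_mul, fn_zf h01, fn_zf h01, pfun] at h1
    norm_num at h1
  refine hne (huniq (G + L) fun α ↦ ?_)
  have hGs : IsSmoothForm (G α : MForm 𝓙 unitInterval ℝ 0) := (G α).2
  set c := fn (α : MForm 𝓙 unitInterval ℝ 0) 0
  have hsum : IsSmoothForm ((G α : MForm 𝓙 unitInterval ℝ 0) + c • zf pfun) := hGs.add (hPs.smul c)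
  refine ⟨fun η hη ↦ ?_, ?_⟩
  · -- `(G + L) α` is `L²`-orthogonal to `harmonicForms`
    obtain ⟨hηs, a, b, hab⟩ := isAff_of_mem_harmonicForms _ hη
    have h0 := (hG α).1 η hη
    rw [l2Inner_eq hGs hηs] at h0
    rw [hL, l2Inner_eq hsum hηs, fn_add, fn_smul]
    have hi1 : IntervalIntegrable (fun t ↦ fn (G α : MForm 𝓙 unitInterval ℝ 0) t * fn η t) volume 0 1 :=
      ((contDiffOn_fn hGs).continuousOn.mul (contDiffOn_fn hηs).continuousOn).intervalIntegrable_of_Icc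
        zero_le_one
    have hi2 : IntervalIntegrable (fun t ↦ fn (zf pfun) t * fn η t) volume 0 1 :=
      ((contDiffOn_fn hPs).continuousOn.mul (contDiffOn_fn hηs).continuousOn).intervalIntegrable_of_Icc
        zero_le_one
    have hp : ∫ t in (0 : ℝ)..1, fn (zf pfun) t * fn η t = 0 := by
      rw [intervalIntegral.integral_congr (g := fun t ↦ pfun t * (a + b * t)) fun t ht ↦ ?_]
      · exact integral_pfun_mul_affine a b
      · rw [uIcc_of_le zero_le_one] at ht
        simp only
        rw [fn_zf ht, hab t ht]
    calc K * ∫ t in (0 : ℝ)..1, (fn (G α : MForm 𝓙 unitInterval ℝ 0) + c • fn (zf pfun)) t * fn η t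
        = K * ((∫ t in (0 : ℝ)..1, fn (G α : MForm 𝓙 unitInterval ℝ 0) t * fn η t) +
            c * ∫ t in (0 : ℝ)..1, fn (zf pfun) t * fn η t) := by
          congr 1
          rw [← intervalIntegral.integral_const_mul, ← intervalIntegral.integral_add hi1 (hi2.const_mul c)]
          refine intervalIntegral.integral_congr fun t _ ↦ ?_
          simp only [Pi.add_apply, Pi.smul_apply, smul_eq_mul]
          ring
      _ = 0 := by rw [hp, mul_zero, add_zero, h0]
  · -- `α - Δ((G + L) α)` lies in `harmonicForms`
    rw [hL, hodgeLaplacian_add _ hGs (hPs.smul c), hodgeLaplacian_smul _ c hPs, hodgeLaplacian_zf_pfun,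
      ← sub_sub]
    exact sub_mem (hG α).2
      (Submodule.smul_mem _ c (subset_harmonicForms _ _ (isHarmonicForm_zf_const _ (-12))))

end WithMetric

end GreenCounterexample

section UniversalClosure

attribute [local instance] GreenCounterexample.bundle GreenCounterexample.factFinrank

-- names the `@[deprecated]` record `existsUnique_greenOperator` on purpose (verdict clean-up 2026-08-15); REMOVE-WHEN the
-- record is deleted from `L2HodgeTheory.lean`
set_option linter.deprecated false in
/-- **`existsUnique_greenOperator` cannot be discharged as stated**: its universal closure is
false — already over *compact* charted spaces modelled on `[0,1]` with a constant metric
(witness `GreenCounterexample.not_existsUnique_greenOperator_unitInterval`); the hypothesis the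
fact fails to bind is `I.Boundaryless` (Warner (1983), 6.9–6.10 concern closed manifolds). [folklore] -/
theorem not_forall_existsUnique_greenOperator :
    ¬ ∀ (M : Type) [TopologicalSpace M] [ChartedSpace unitInterval M] [T2Space M]
        [SigmaCompactSpace M] [CompactSpace M] [IsManifold GreenCounterexample.𝓙 ∞ M]
        [Bundle.RiemannianBundle (fun x : M ↦ TangentSpace GreenCounterexample.𝓙 x)]
        (o : (x : M) → Orientation ℝ (TangentSpace GreenCounterexample.𝓙 x) (Fin 1)),
        existsUnique_greenOperator (k := 0) (m := 1) o :=
  fun H ↦ GreenCounterexample.not_existsUnique_greenOperator_unitInterval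
    (H unitInterval GreenCounterexample.orient)

end UniversalClosure

end Literature.NumberTheory.Transcendental
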